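import Mathlib.Data.ENat.Lattice
import Literature.AlgebraicGeometry.Hu2025.Statements.S06WpEllBlowups.R107bWpSets

/-!
# Hu 2025 (arXiv:2507.21400v1), §6.2.1 second half and §6.2.2 (PDF §6b.1/§6b.2): the ℘-blow-up sequence, Def. 6.6,
# (6.2) Φ_k / Index_{Φ_k}, Def. 6.7 (ρ_(kτ)), (6.3), Def. 6.8 (χ_k, ℓ-blow-up), Def. 6.9, (6.7) Ω — file
# `S06WpEllBlowups/R107cWpEllBlowups.lean` (3/3) of lit/PARTITION-HU.md row 107, typed by res-type-018 (pre-draft gen 4; T9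
# re-read + filing gen 5, after the 08:00Z re-pointing line). Imports `R107bWpSets` (after `R107aAssociation`: frame `WpFrame`,
# divisor names `Div`, stages `Stage`, tables `AssocB/AssocS`, Def. 6.1–6.5). Source status and tags as in file a — UNREFEREED
# PREPRINT UNDER ADJUDICATION; every decl `[claim: Hu2025, status: under-review]` — «STATUS: candidate statement under
# adjudication (D-0012/D-0089); not asserted»; nothing is proved or asserted; AI typing, weaker than expert review.

## Items ↦ declarations (this file; numbered items / claims / equations at `Literature.AlgebraicGeometry.Hu2025.Statements.S06WpEllBlowups.`,
## helpers at `….S06WpEllBlowups.WpFrame.`)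
* the ℘-blow-ups of the round C44L40–L60; p.100 («ℛ̃_{(℘_(kτ)𝔯_μ𝔰_h)} → ℛ̃_{(℘_(kτ)𝔯_μ𝔰_{h−1})} be the blowup … along (the proper
  transform of) the ℘-center Z_{ϕ_(kτ)μh}») ↦ at data level the new name `Div.excWp k τ μ h`; chart level = a `ChartStep`
  (row 106 I-CH) with centre the two divisor variables — row 108 (Prop. 6.11 proof frame C48L94–L105).
* the divisor sets 𝒟_{(℘_(kτ)𝔯_μ𝔰_h)}, ℰ_old, ℰ_new, 𝒟̄ (C44L62–C45L34; p.100–101) and the package's ℰ_{(℘_(kτ)𝔯_{μ−1})}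
  (C43L39–L47; p.98) ↦ `IsIndexPhi`/`IndexPhi` (= (6.2)), `Div.IsLive`, `divsAt` (by stage), `divsBefore`.
* Def. 6.6 C45L42–L91; p.102 ↦ `Def6_6_mPhi` (m_{ϕ,T^i_B}), `Def6_6_lPhi` (l_{ϕ,B}), `Def6_6_exc` (m_{E,T^i_B}), `Def6_6_excS`
  (m_{E,s}), `Def6_6` (the updated tables); the parenthetical claim C45L74 ↦ `C45L74`.
* recap C45L93–L113; p.102–103 ↦ docstrings (the conventions (℘_(kτ)𝔯_{ρ+1}) := (℘_(k(τ+1))𝔯_1) etc. are identifications of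
  stages); diagram (6.1) C45L117–L124 ↦ no decl (diagram); «Ṽ_{(℘_(kτ)𝔯_μ)} = Ṽ_{(℘_(kτ)𝔯_μ𝔰_σ)}» C45L126 ↦ docstring.
* Def. 6.7 C45L128–L141; p.103 ↦ `Def6_7` (ρ_(kτ) ∈ ℕ∞); «It will be shown soon that ρ_(kτ) is finite» ↦ `C45L139`.
* (6.2) Φ_k, Index_{Φ_k} C45L143–L156; p.103 ↦ `IndexPhi` (= `Eq6_2`); «the order of ℘_k-blowups coincides with the
  lexicographical order on Index_{Φ_k}» ↦ `Stage.LT` (file a), docstring.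
* (6.3) C46L1–L15; p.103 («ℛ̃_{℘_k} := … the blowup scheme reached in the final step») ↦ `Stage.wpEnd` (the name of the final
  ℘-stage of block k); diagram (6.4) C46L17–L25 ↦ no decl.
* Def. 6.8 C46L29–L60; p.104 ↦ `Def6_8` (χ_k), `ellCentreIdeal`, `IsEllSet` (+ chart readings `Def6_8_testChart_R1/_R2` of the
  printed test «Z_{χ_k} ∩ ℛ̃_{℘_k} ≠ ∅»), the belief sentence C46L50–L52 ↦ `C46L50`.
* divisors in (ℓ_k) C46L62–L74; p.104 ↦ `divsAt` at `Stage.ellStage k` (+ name `Div.excEll k`).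
* Def. 6.9 C46L79–L102; p.105 ↦ `Def6_9`.
* diagrams (6.5), (6.6) C46L104–L121 ↦ no decl; conventions C46L123–C47L1 (ℓ_k = (k𝔱_{F_k})ρ(σ+1)) ↦ `Stage` docstrings.
* (6.7) Ω C46L155–C47L7; p.106 ↦ `Omega` (= `Eq6_7`); «totally ordered … coincides with the lexicographical order» ↦ `C47L4`.
* the whole inductive construction as ONE datum ↦ `WpRun` + `WpRun.IsAsPrinted` (OURS packaging: what rows 108/110 quantify over).

## Reading / sic notes (none takes a side)
8. Def. 6.6 C45L77 prints «m_{E,T^i_B} = m_{ϕ,T^i_B} − l_{ϕ,T^i_B}» with `l_{ϕ,B}` just defined (C45L72) [sic: `l_{ϕ,B}`]; typed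
   with `l_{ϕ,B}` (the only defined symbol) — the literal `l_{ϕ,T^i_B}` has no definiens.
9. Def. 6.8 C46L47–L48 tests «Z_{χ_k} ∩ ℛ̃_{℘_k} ≠ ∅» (Z_{χ_k} ⊂ ℛ̃_{℘_k}, so literally: Z_{χ_k} ≠ ∅), whereas Def. 6.4 tests
   against Ṽ. Both chart readings are offered (`_R1` literal, `_R2` the Ṽ-analogue); the data-level `IsEllSet` takes the test as
   a parameter. C46L50–L52 «Indeed, we believe that the intersection … is always non-empty. But, the non-empty assumption possesses
   no harm» is typed as the candidate `C46L50` (prior record G-H6 = INDEX ONLY).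
10. C43L41–L42 (p.98) indexes the exceptional divisors of ℛ̃_{(℘_(kτ)𝔯_{μ−1})} by «(11)0 ≤ (k'τ')μ' ≤ (kτ)(μ−1), h' ∈ [σ_{(k'τ')μ'}]»
   with «σ_{(11)0} = Υ» counting the ϑ-exceptional divisors (C43L46–L47: «on ℛ̃_{(℘_1𝔯_1𝔰_0)} = ℛ̃_ϑ» [sic: (℘_(11)𝔯_1𝔰_0), cf.
   C46L125–L126]); the ℓ_j-exceptional divisors `E_{ℓ_j}`, `j < k`, are not in that displayed range literally but are divisors
   of the scheme (C46L65–L72 «inherit its original name … E_{ℓ_k}»; Prop. 6.11's 𝔩-exceptional divisors C47L94–L97): `divsAt`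
   includes them (reading recorded).
11. C43L8 «1 ≤ ρ_(kτ) ≤ ∞» vs Def. 6.7 (ρ_(kτ) = the least μ ≥ ? with no ℘-set in round μ+1 — `0` is not excluded by the
   wording «finite integer μ»): `Def6_7` takes the infimum over all `μ : ℕ`; recorded.
-/

noncomputable section

namespace Literature.AlgebraicGeometry.Hu2025.Statements.S06WpEllBlowups

universe u v w

namespace WpFrame

variable {P : Type v} {Λ : Type v} [DecidableEq P] [DecidableEq Λ]
variable (W : WpFrame P Λ)

/-! ## (6.2) and the divisors present at a stage -/

/-- **Membership in `Index_{Φ_k}` ((6.2) C45L151–L153; p.103): «Index_{Φ_k} = {(kτ)μh ∣ τ ∈ [𝔱_{F_k}], μ ∈ [ρ_(kτ)], h ∈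
[σ_(kτ)μ]}»** — for PRINTED naturals `τ, μ, h` (all `≥ 1`), given the numbers of rounds `ρ_(kτ)` («granting the finiteness
of ρ_(kτ)», C45L143) and of ℘-sets per round `σ_(kτ)μ` (C44L32) as functions on `Index_{𝓑^gov}`.
[claim: Hu2025, status: under-review]
STATUS: candidate statement under adjudication (D-0012/D-0089); not asserted. -/
def IsIndexPhi (ρ : W.IndexBgov → ℕ) (σ : W.IndexBgov → ℕ → ℕ) (k : Fin W.N) (τ μ h : ℕ) : Prop :=
  ∃ τ' : Fin (W.t k), τ'.val + 1 = τ ∧ 1 ≤ μ ∧ μ ≤ ρ ⟨k, τ'⟩ ∧ 1 ≤ h ∧ h ≤ σ ⟨k, τ'⟩ μ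

/-- **(6.2) `Φ_k = {ϕ_(kτ)μh ∣ τ ∈ [𝔱_{F_k}], μ ∈ [ρ_(kτ)], h ∈ [σ_(kτ)μ]}` / `Index_{Φ_k}` (C45L143–L156; p.103).** The index set
as a set of printed triples `(τ, μ, h)`; `Φ_k` is its image under the listing `ϕ_(kτ)μh` (`IsPhiListing`, file b; `WpRun.phi`).
C45L155–L156: «the order of ℘_k-blowups coincides with the lexicographical order on Index_{Φ_k}» = `Stage.LT`.
[claim: Hu2025, status: under-review]
STATUS: candidate statement under adjudication (D-0012/D-0089); not asserted. -/
def IndexPhi (ρ : W.IndexBgov → ℕ) (σ : W.IndexBgov → ℕ → ℕ) (k : Fin W.N) : Set (ℕ × ℕ × ℕ) :=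
  {x | W.IsIndexPhi ρ σ k x.1 x.2.1 x.2.2}

/-- (6.2) under its equation number. Alias of `IndexPhi`.
[claim: Hu2025, status: under-review]
STATUS: candidate statement under adjudication (D-0012/D-0089); not asserted. -/
abbrev _root_.Literature.AlgebraicGeometry.Hu2025.Statements.S06WpEllBlowups.Eq6_2 (W : WpFrame P Λ) (ρ : W.IndexBgov → ℕ) (σ : W.IndexBgov → ℕ → ℕ) (k : Fin W.N) : Set (ℕ × ℕ × ℕ) := W.IndexPhi ρ σ k

namespace Div

variable {W}

/-- The ℘-index `(k, τ, μ, h)` of a ℘-exceptional name, `none` for all other names. Plumbing (cheap decidable lookups).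
[claim: Hu2025, status: under-review]
STATUS: candidate statement under adjudication (D-0012/D-0089); not asserted. -/
def wpIdx (Y : W.Div) : Option (Fin W.N × ℕ × ℕ × ℕ) :=
  Div.cases (fun _ => none) (fun _ => none) (fun _ => none) (fun _ => none) (fun x => some x) (fun _ => none) Y

/-- The block `k` of an ℓ-exceptional name `E_{ℓ_k}`, `none` for all other names. Plumbing.
[claim: Hu2025, status: under-review]
STATUS: candidate statement under adjudication (D-0012/D-0089); not asserted. -/
def ellIdx (Y : W.Div) : Option (Fin W.N) :=
  Div.cases (fun _ => none) (fun _ => none) (fun _ => none) (fun _ => none) (fun _ => none) (fun k => some k) Y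

/-- **The names that occur at all in the construction** (given `ρ`, `σ`): every ϖ-, ϱ-, 𝔏-, ϑ- and ℓ-name, and the ℘-names
`E_{·,(kτ)μh}` with `(kτ)μh ∈ Index_{Φ_k}` ((6.2); C44L110–L120).
[claim: Hu2025, status: under-review]
STATUS: candidate statement under adjudication (D-0012/D-0089); not asserted — OURS bookkeeping. -/
def IsLive (ρ : W.IndexBgov → ℕ) (σ : W.IndexBgov → ℕ → ℕ) (Y : W.Div) : Prop :=
  Div.cases (fun _ => True) (fun _ => True) (fun _ => True) (fun _ => True)
    (fun x => W.IsIndexPhi ρ σ x.1 x.2.1 x.2.2.1 x.2.2.2) (fun _ => True) Y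

end Div

/-- **The divisor set `𝒟` of the scheme at a stage** — `𝒟_ϑ` (C42L50–L52), `𝒟_{(℘_(kτ)𝔯_μ𝔰_h)} = 𝒟̄ ⊔ ℰ_new`
(C44L62–C45L9; p.100–101: the proper transforms of all ϖ-, ϱ-divisors and of the exceptional divisors `E_{…,(k'τ')μ'h'}`,
«(11)0 ≤ (k'τ')μ' ≤ (kτ)(μ−1), h' ∈ [σ_{(k'τ')μ'}]», plus the new `E_{…,(kτ)μh'}`, `1 ≤ h' ≤ h`), and after the ℓ_k-blow-up
the same with `E_{ℓ_k}` added (C46L65–L72; p.104).** Typed uniformly: a live name belongs to the stage `s` iff it is a ϖ-,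
ϱ- or ϑ-exceptional name, or an exceptional name created at a stage `≤ s` (`Div.birth`, `Stage.LT`). 𝔏-divisors are kept
apart (`LDivs`, «will not be used until the ℓ-blowup»). Reading note 10 (ℓ_j-exceptional divisors of earlier blocks are
included). The identifications `(℘_(kτ)𝔯_μ𝔰_0) = (℘_(kτ)𝔯_{μ−1})` etc. hold automatically (no name is born at `h = 0`).
[claim: Hu2025, status: under-review]
STATUS: candidate statement under adjudication (D-0012/D-0089); not asserted. -/
def divsAt (ρ : W.IndexBgov → ℕ) (σ : W.IndexBgov → ℕ → ℕ) (s : W.Stage) : Set W.Div :=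
  {Y | Y.IsLive ρ σ ∧ (Y ∈ W.divsTheta ∨ ∃ b, Y.birth = some b ∧ (b = s ∨ Stage.LT b s))}

/-- **`𝒟_{(℘_(kτ)𝔯_{μ−1})}`, the divisors available for the pre-℘-sets of round `μ` of `B_(kτ)`** (Def. 6.4 C43L98–L100 «two
divisors of the scheme ℛ̃_{(℘_(kτ)𝔯_{μ−1})}»; C44L52–L55 «ℛ̃_{(℘_(kτ)𝔯_μ𝔰_0)} := ℛ̃_{(℘_(kτ)𝔯_{μ−1})} := ℛ̃_{(℘_(kτ)𝔯_{μ−1}𝔰_{σ_(kτ)(μ−1)})}»,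
with C43L12–L18 / C46L123–L126 for `μ = 1`: the end of the previous binomial's rounds, of the previous block's ℓ-blow-up, or
`ℛ̃_ϑ`): all live names born strictly before the stage `(℘_(kτ)𝔯_μ𝔰_1)`.
[claim: Hu2025, status: under-review]
STATUS: candidate statement under adjudication (D-0012/D-0089); not asserted. -/
def divsBefore (ρ : W.IndexBgov → ℕ) (σ : W.IndexBgov → ℕ → ℕ) (kτ : W.IndexBgov) (μ : ℕ) : Set W.Div :=
  {Y | Y.IsLive ρ σ ∧ (Y ∈ W.divsTheta ∨ ∃ b, Y.birth = some b ∧ Stage.LT b (Stage.wp kτ.1 (kτ.2.val + 1) μ 1))}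

/-! ## Def. 6.6 — multiplicities of the new exceptional divisor -/

/-- **`m_{ϕ,T^i_B} = m_{Y⁺,T^i_B} + m_{Y⁻,T^i_B}`, `i = 0, 1` (Def. 6.6 C45L68–L70; p.102)** for `ϕ = {Y⁺, Y⁻}` and the current
table `m`.
[claim: Hu2025, status: under-review]
STATUS: candidate statement under adjudication (D-0012/D-0089); not asserted. -/
def Def6_6_mPhi {Bin : Type w} (m : W.AssocB Bin) (Yp Ym : W.Div) (B : Bin) (i : Fin 2) : ℕ := m Yp B i + m Ym B i

/-- **`l_{ϕ,B} = min {m_{ϕ,T⁰_B}, m_{ϕ,T¹_B}}` (Def. 6.6 C45L72; p.102).**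
[claim: Hu2025, status: under-review]
STATUS: candidate statement under adjudication (D-0012/D-0089); not asserted. -/
def Def6_6_lPhi {Bin : Type w} (m : W.AssocB Bin) (Yp Ym : W.Div) (B : Bin) : ℕ :=
  min (W.Def6_6_mPhi m Yp Ym B 0) (W.Def6_6_mPhi m Yp Ym B 1)

/-- **`m_{E_{(℘_(kτ)𝔯_μ𝔰_h)},T^i_B} = m_{ϕ,T^i_B} − l_{ϕ,B}` (Def. 6.6 C45L75–L77; p.102)** [printed «− l_{ϕ,T^i_B}», sic — note 8].
[claim: Hu2025, status: under-review]
STATUS: candidate statement under adjudication (D-0012/D-0089); not asserted. -/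
def Def6_6_exc {Bin : Type w} (m : W.AssocB Bin) (Yp Ym : W.Div) (B : Bin) (i : Fin 2) : ℕ :=
  W.Def6_6_mPhi m Yp Ym B i - W.Def6_6_lPhi m Yp Ym B

/-- **`m_{E_{(℘_(kτ)𝔯_μ𝔰_h)},s} = m_{Y⁺,s} + m_{Y⁻,s}` (Def. 6.6 C45L79–L83; p.102).**
[claim: Hu2025, status: under-review]
STATUS: candidate statement under adjudication (D-0012/D-0089); not asserted. -/
def Def6_6_excS (mS : W.AssocS) (Yp Ym : W.Div) (s : W.STerm) : ℕ := mS Yp s + mS Ym s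

/-- **Definition 6.6 (C45L42–L91; p.102) — the «association» after the blow-up `(℘_(kτ)𝔯_μ𝔰_h)`.** «Fix any B ∈ 𝓑^gov ⊔ 𝓑^𝔯𝔟
… Consider an arbitrary divisor Y ∈ 𝒟_{(℘_(kτ)𝔯_μ𝔰_h)}. First, suppose Y ≠ E_{(℘_(kτ)𝔯_μ𝔰_h)}. Then, it is the proper transform
of a (unique) divisor Y' ∈ 𝒟_{(℘_(kτ)𝔯_μ𝔰_{h−1})}. In this case, we set m_{Y,T_B} = m_{Y',T_B}, m_{Y,s} = m_{Y',s}. Next, we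
consider the exceptional Y = E_{(℘_(kτ)𝔯_μ𝔰_h)}. We let ϕ = ϕ_(kτ)μh. We have that ϕ = {Y⁺, Y⁻} ⊂ 𝒟_{(℘_(kτ)𝔯_{μ−1})}. For any
B ∈ 𝓑^gov ∪ 𝓑^𝔯𝔟, we write B = T⁰_B − T¹_B. We let m_{ϕ,T^i_B} = m_{Y⁺,T^i_B} + m_{Y⁻,T^i_B}, i = 0,1, l_{ϕ,B} = min{m_{ϕ,T⁰_B},
m_{ϕ,T¹_B}}. (For instance, by definition, l_{ϕ,B} > 0 when B = B_(kτ). In general, it can be zero.) Then, we let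
m_{E,T^i_B} = m_{ϕ,T^i_B} − l_{ϕ,T^i_B} [sic]. Likewise, for s ∈ S_F with F ∈ 𝔉, we let m_{E,s} = m_{Y⁺,s} + m_{Y⁻,s}.» Typed on
names (proper transforms keep their name, so «m_{Y,T_B} = m_{Y',T_B}» is the identity on old names): the tables after the
step are the tables before it, updated at the ONE new name `E = E_{·,(kτ)μh}` (`Div.excWp k τ μ h`, printed `τ μ h`) from the
entries of `Y⁺`, `Y⁻` (which, being divisors of ℛ̃_{(℘_(kτ)𝔯_{μ−1})}, carry the same entries in every later table).
[claim: Hu2025, status: under-review]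
STATUS: candidate statement under adjudication (D-0012/D-0089); not asserted. -/
def _root_.Literature.AlgebraicGeometry.Hu2025.Statements.S06WpEllBlowups.Def6_6 (W : WpFrame P Λ) {Bin : Type w} (m : W.AssocB Bin) (mS : W.AssocS) (k : Fin W.N) (τ μ h : ℕ) (Yp Ym : W.Div) :
    W.AssocB Bin × W.AssocS :=
  (fun Y B i => if Y.wpIdx = some (k, τ, μ, h) then W.Def6_6_exc m Yp Ym B i else m Y B i,
   fun Y s => if Y.wpIdx = some (k, τ, μ, h) then W.Def6_6_excS mS Yp Ym s else mS Y s)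

/-- **Def. 6.6, the parenthetical claim C45L74 (p.102): «by definition, l_{ϕ,B} > 0 when B = B_(kτ)»** — for a pre-℘-set
`ϕ = {Y⁺,Y⁻}` in `(℘_(kτ)𝔯_μ)` (`Y^±` associated with `T^±_(kτ)`) and the table `m` whose `(kτ)`-column defines it.
[claim: Hu2025, status: under-review]
STATUS: candidate statement under adjudication (D-0012/D-0089); not asserted. -/
def _root_.Literature.AlgebraicGeometry.Hu2025.Statements.S06WpEllBlowups.C45L74 (W : WpFrame P Λ) {Bin : Type w} (gov : W.IndexBgov → Bin) (m : W.AssocB Bin) (kτ : W.IndexBgov) {𝒟 : Set W.Div}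
    (φ : PreWpSet W 𝒟 (fun Y i => m Y (gov kτ) i)) : Prop :=
  0 < W.Def6_6_lPhi m φ.plus φ.minus (gov kτ)

/-! ## Def. 6.7 — the number of rounds `ρ_(kτ)` -/

/-- **Definition 6.7 (C45L128–L137; p.103).** «Fix any k ∈ [Υ], τ ∈ [𝔱_{F_k}]. Suppose there exists a finite integer μ such
that for any pre-℘-set ϕ in (℘_(kτ)𝔯_{μ+1}) (cf. Definition 6.4), we have Z_ϕ ∩ Ṽ_{(℘_(kτ)𝔯_μ)} = ∅. Then, we let ρ_(kτ) be
the smallest integer such that the above holds. Otherwise, we let ρ_(kτ) = ∞.» Typed in `ℕ∞` as the infimum of the `μ`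
such that NO pre-℘-set of round `μ+1` passes the test: the data of round `μ+1` are the name set `𝒟 μ` (= 𝒟_{(℘_(kτ)𝔯_μ)}),
the `(kτ)`-column `m μ` of the table at that stage and the test `meetsV μ` against `Ṽ_{(℘_(kτ)𝔯_μ)}` — all supplied by the
run (`WpRun`); reading note 11.
[claim: Hu2025, status: under-review]
STATUS: candidate statement under adjudication (D-0012/D-0089); not asserted. -/
def _root_.Literature.AlgebraicGeometry.Hu2025.Statements.S06WpEllBlowups.Def6_7 (W : WpFrame P Λ) (𝒟 : ℕ → Set W.Div) (m : ℕ → W.Div → Fin 2 → ℕ) (meetsV : ℕ → W.Div → W.Div → Prop) : ℕ∞ :=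
  ⨅ (μ : ℕ) (_ : ∀ φ : PreWpSet W (𝒟 μ) (m μ), ¬ IsWpSet W (meetsV μ) φ), (μ : ℕ∞)

/-- **C45L139–L141 (p.103), the claim: «It will be shown soon that ρ_(kτ) is finite for all k ∈ [Υ], τ ∈ [𝔱_{F_k}]»**
(forward reference to Prop. 6.18 (3) «ρ_(kτ) < ∞», row 108 `Prop6_18_3_rounds`). Typed for given round data.
[claim: Hu2025, status: under-review]
STATUS: candidate statement under adjudication (D-0012/D-0089); not asserted. -/
def _root_.Literature.AlgebraicGeometry.Hu2025.Statements.S06WpEllBlowups.C45L139 (W : WpFrame P Λ) (𝒟 : ℕ → Set W.Div) (m : ℕ → W.Div → Fin 2 → ℕ) (meetsV : ℕ → W.Div → W.Div → Prop) : Prop :=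
  Def6_7 W 𝒟 m meetsV ≠ ⊤

namespace Stage

variable {W}

/-- **`℘_k`, the final stage of the ℘-blow-ups of the block `𝔊_k` ((6.3) C46L6–L15; p.103: «ℛ̃_{℘_k} :=
ℛ̃_{(℘_(k𝔱_{F_k})𝔯_{ρ_{k𝔱}})} := ℛ̃_{(℘_(k𝔱_{F_k})𝔯_{ρ}𝔰_{σ_{(k𝔱)ρ}})} is the blowup scheme reached in the final step … of all
℘-blowups in (𝔊_k)»),** given `ρ`, `σ`. (When `𝔱_{F_k} = 0` or `ρ = 0` the formula names a stage with `τ = 0` or `μ = 0`,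
i.e. an earlier stage by the printed identifications — recorded.)
[claim: Hu2025, status: under-review]
STATUS: candidate statement under adjudication (D-0012/D-0089); not asserted. -/
def wpEnd (ρ : W.IndexBgov → ℕ) (σ : W.IndexBgov → ℕ → ℕ) (k : Fin W.N) : W.Stage :=
  if ht : 0 < W.t k then
    wp k (W.t k) (ρ ⟨k, ⟨W.t k - 1, Nat.sub_one_lt_of_le ht le_rfl⟩⟩)
      (σ ⟨k, ⟨W.t k - 1, Nat.sub_one_lt_of_le ht le_rfl⟩⟩ (ρ ⟨k, ⟨W.t k - 1, Nat.sub_one_lt_of_le ht le_rfl⟩⟩))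
  else wp k 0 0 0

end Stage

/-! ## Def. 6.8 — the ℓ-blow-up of the block -/

/-- **Definition 6.8, the pre-ℓ-set `χ_k` and its centre (C46L29–L43; p.104).** «Let D_{℘_k,L_{F_k}} be [the] proper transform
of the 𝔏-divisor defined by L_{F_k} and E_{℘_k,ϑ_k} be the proper transform of the exceptional divisor E_{ϑ,k} (of ℛ̃_ϑ) in
ℛ̃_{℘_k}. We call the set of the two divisors χ_k = {D_{℘_k,L_{F_k}}, E_{℘_k,ϑ_k}} the pre-ℓ-set with respect to L_{F_k} or just
pre-ℓ_k-set. We let Z_{χ_k} be the scheme-theoretic intersection Z_{χ_k} = D_{℘_k,L_{F_k}} ∩ E_{℘_k,ϑ_k}.» On names: the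
ORDERED pair `(D_{·,L_{F_k}}, E_{ϑ,k})` (the order `(Y'_0, Y'_1) = (D_{℘_k,L_{F_k}}, E_{℘_k,ϑ_k})` of Prop. 6.11's proof frame
C48L99–L102). PARTITION names `Def6_8`, `ellCentre` (chart ideal: `ellCentreIdeal`).
[claim: Hu2025, status: under-review]
STATUS: candidate statement under adjudication (D-0012/D-0089); not asserted. -/
def _root_.Literature.AlgebraicGeometry.Hu2025.Statements.S06WpEllBlowups.Def6_8 (W : WpFrame P Λ) (k : Fin W.N) : W.Div × W.Div := (Div.ell k, Div.excTheta k)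

section Chart

variable {A : Type u} [CommRing A]

/-- **The ℓ-centre `Z_{χ_k} = D_{℘_k,L_{F_k}} ∩ E_{℘_k,ϑ_k}` on an affine chart of `ℛ̃_{℘_k}`** (C46L41–L43): the sum of the two
chart ideals (`divI` as in `wpCentreIdeal`). PARTITION name `ellCentre`.
[claim: Hu2025, status: under-review]
STATUS: candidate statement under adjudication (D-0012/D-0089); not asserted. -/
def ellCentreIdeal (divI : W.Div → Ideal A) (k : Fin W.N) : Ideal A :=
  divI (Div.ell k) ⊔ divI (Div.excTheta k)

/-- **`ellCentre` — lit/PARTITION-HU.md row 107's expected name for the ℓ-centre `Z_{χ_k} = D_{℘_k,L_{F_k}} ∩ E_{℘_k,ϑ_k}`**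
(C46L41–L43; p.104) on an affine chart: alias of `ellCentreIdeal` (name concordance only).
[claim: Hu2025, status: under-review]
STATUS: candidate statement under adjudication (D-0012/D-0089); not asserted. -/
abbrev ellCentre (divI : W.Div → Ideal A) (k : Fin W.N) : Ideal A := W.ellCentreIdeal divI k

/-- **Def. 6.8's test, chart reading R1 (LITERAL): «Z_{χ_k} ∩ ℛ̃_{℘_k} ≠ ∅» (C46L47–L48)** — `Z_{χ_k}` lies in `ℛ̃_{℘_k}`, so the
printed condition is `Z_{χ_k} ≠ ∅`; on a chart: the centre ideal is proper. Reading note 9.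
[claim: Hu2025, status: under-review]
STATUS: candidate statement under adjudication (D-0012/D-0089); not asserted — reading R1 of a printed test. -/
def Def6_8_testChart_R1 (divI : W.Div → Ideal A) (k : Fin W.N) : Prop :=
  W.ellCentreIdeal divI k ≠ ⊤

/-- **Def. 6.8's test, chart reading R2 (by analogy with Def. 6.4's «Z_ϕ ∩ Ṽ ≠ ∅»): «Z_{χ_k} ∩ Ṽ_{℘_k} ≠ ∅» on the chart**
with `vI` the chart ideal of `Ṽ_{℘_k}`. NOT the printed wording (which has ℛ̃); offered because Prop. 6.11's proof
(C48L129–L132 «we only need to focus on the situation when Z'_{ϕ} meets Ṽ … along a nonempty closed subset») treats the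
℘- and ℓ-centres alike — reading note 9; the adjudication decides, nothing is asserted.
[claim: Hu2025, status: under-review]
STATUS: candidate statement under adjudication (D-0012/D-0089); not asserted — reading R2 (OURS) of a printed test. -/
def Def6_8_testChart_R2 (vI : Ideal A) (divI : W.Div → Ideal A) (k : Fin W.N) : Prop :=
  W.ellCentreIdeal divI k ⊔ vI ≠ ⊤

end Chart

/-- **Definition 6.8, second part (C46L45–L60; p.104): ℓ-sets and the ℓ-blow-up.** «The pre-ℓ-set χ_k (resp. Z_{χ_k}) is
called a ℓ-set (resp. ℓ-center) with respect to L_{F_k} if Z_{χ_k} ∩ ℛ̃_{℘_k} ≠ ∅. … We then let ℛ̃_{ℓ_k} → ℛ̃_{℘_k} be the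
blowup of ℛ̃_{℘_k} along Z_{χ_k}. This is called the ℓ-blowup with respect to F_k or in (𝔊_k), or simply ℓ_k-blowup.» The
TEST is the explicit parameter `meetsR` (chart readings `Def6_8_testChart_R1/_R2`); at data level the blow-up creates the
name `Div.excEll k` at the stage `Stage.ellStage k` (C46L70–L72).
[claim: Hu2025, status: under-review]
STATUS: candidate statement under adjudication (D-0012/D-0089); not asserted. -/
def IsEllSet (meetsR : W.Div → W.Div → Prop) (k : Fin W.N) : Prop :=
  meetsR (Def6_8 W k).1 (Def6_8 W k).2

/-- **C46L50–L52 (p.104), typed as the candidate it states: «Indeed, we believe that the intersection Z_{χ_k} ∩ ℛ̃_{℘_k} is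
always non-empty. But, the non-empty assumption possesses no harm for what to follow.»** — every pre-ℓ-set is an ℓ-set
(for the supplied test). Printed as a belief, not as a claim with proof; recorded as such.
[claim: Hu2025, status: under-review]
STATUS: candidate statement under adjudication (D-0012/D-0089); not asserted. -/
def _root_.Literature.AlgebraicGeometry.Hu2025.Statements.S06WpEllBlowups.C46L50 (W : WpFrame P Λ) (meetsR : W.Div → W.Div → Prop) : Prop := ∀ k : Fin W.N, W.IsEllSet meetsR k

/-! ## Def. 6.9 — «association» after the ℓ-blow-up -/

/-- **Definition 6.9 (C46L79–L102; p.105).** «Fix any binomial B ∈ 𝓑^gov_G ⊔ B^𝔯𝔟 with G > F_k, written as B = T⁺_B − T⁻_B. For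
any F̄ ∈ 𝔉, let T_s be the term of L_F corresponding to some fixed s ∈ S_F. As assumed, the notion of "association" in (℘_k)
has been introduced. … Suppose a divisor Y of ℛ̃_{ℓ_k} is the proper transform of Y' of ℛ̃_{℘_k}. We define m_{Y,T^±_B} =
m_{Y',T^±_B}, m_{Y,s} = m_{Y',s}. We define m_{E_{ℓ_k},T^±_B} = m_{E_{℘_k,ϑ_k},T^±_B}, m_{E_{ℓ_k},s} = m_{E_{℘_k,ϑ_k},s}.» Typed
on names: the tables after the ℓ_k-blow-up are those before it, extended at the new name `E_{ℓ_k}` by the entries of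
`E_{ϑ,k}` (= `E_{℘_k,ϑ_k}`, same name). The print defines these entries only for `B ∈ 𝓑^gov_G ⊔ 𝓑^𝔯𝔟`, `G > F_k` (the
governing binomials of the blocks `≤ k` have terminated, Prop. 6.18 (3)); this FUNCTION fills every column alike (a total
function is needed), while the REQUIREMENT `WpRun.IsAsPrinted` (e) constrains only the printed columns (`later`).
[claim: Hu2025, status: under-review]
STATUS: candidate statement under adjudication (D-0012/D-0089); not asserted. -/
def _root_.Literature.AlgebraicGeometry.Hu2025.Statements.S06WpEllBlowups.Def6_9 (W : WpFrame P Λ) {Bin : Type w} (m : W.AssocB Bin) (mS : W.AssocS) (k : Fin W.N) : W.AssocB Bin × W.AssocS :=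
  (fun Y B i => if Y.ellIdx = some k then m (Div.excTheta k) B i else m Y B i,
   fun Y s => if Y.ellIdx = some k then mS (Div.excTheta k) s else mS Y s)

/-! ## (6.7) Ω -/

/-- **(6.7) `Ω = {(11)10} ⊔ ⨆_{k=1}^{Υ} (Index_{Φ_k} ⊔ {ℓ_k})` (C46L155–L165; p.106),** given `ρ`, `σ`: the set of stages that
occur — the initial one, the ℘-stages indexed by `Index_{Φ_k}` ((6.2)), and the ℓ-stages `ℓ_k`, `k ∈ [Υ]` (the text writes
`ℓ_k := (k𝔱_{F_k})ρ_{k𝔱}(σ+1)` «so that ℓ_k is also in the form of (kτ)μh», C46L162–L165 — an identification recorded in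
`Stage`, not performed). Its linear order is `Stage.LT` (file b).
[claim: Hu2025, status: under-review]
STATUS: candidate statement under adjudication (D-0012/D-0089); not asserted. -/
def Omega (ρ : W.IndexBgov → ℕ) (σ : W.IndexBgov → ℕ → ℕ) : Set W.Stage :=
  {s | s = Stage.init ∨ (∃ (k : Fin W.N) (τ μ h : ℕ), s = Stage.wp k τ μ h ∧ W.IsIndexPhi ρ σ k τ μ h) ∨
    ∃ k : Fin W.N, s = Stage.ellStage k}

/-- (6.7) under its equation number. Alias of `Omega`.
[claim: Hu2025, status: under-review]
STATUS: candidate statement under adjudication (D-0012/D-0089); not asserted. -/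
abbrev _root_.Literature.AlgebraicGeometry.Hu2025.Statements.S06WpEllBlowups.Eq6_7 (W : WpFrame P Λ) (ρ : W.IndexBgov → ℕ) (σ : W.IndexBgov → ℕ → ℕ) : Set W.Stage := W.Omega ρ σ

/-- **C47L4–L7 (p.106), the claim: «the set Ω of (6.7) is totally ordered. Furthermore, this order also coincides with the
lexicographical order on {(kτ)μh}»** (with `ℓ_k = (k𝔱_{F_k})ρ(σ+1)`). Typed: `Stage.LT` is trichotomous and transitive on
`Ω` (the lexicographic clause is the definition of `Stage.LT` on ℘-stages).
[claim: Hu2025, status: under-review]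
STATUS: candidate statement under adjudication (D-0012/D-0089); not asserted. -/
def _root_.Literature.AlgebraicGeometry.Hu2025.Statements.S06WpEllBlowups.C47L4 (W : WpFrame P Λ) (ρ : W.IndexBgov → ℕ) (σ : W.IndexBgov → ℕ → ℕ) : Prop :=
  (∀ a ∈ W.Omega ρ σ, ∀ b ∈ W.Omega ρ σ, a ≠ b → (Stage.LT a b ∨ Stage.LT b a)) ∧
  (∀ a ∈ W.Omega ρ σ, ∀ b ∈ W.Omega ρ σ, ∀ c ∈ W.Omega ρ σ, Stage.LT a b → Stage.LT b c → Stage.LT a c) ∧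
  (∀ a ∈ W.Omega ρ σ, ¬ Stage.LT a a)

/-! ## The whole construction as one datum (OURS packaging) -/

/-- **A run of §6.1–§6.2 at data level, RELATIVE TO THE GEOMETRIC TESTS** (OURS packaging of C42L151–C47L7: «We do it by
induction on the set [Υ]» C42L29; rounds C42L181–C43L18; steps C44L40–L60; Def. 6.6; Def. 6.7; Def. 6.8; Def. 6.9). The
geometric input: `meetsV kτ μ Y Y'` = «Y ∩ Y' ∩ Ṽ_{(℘_(kτ)𝔯_μ)} ≠ ∅» (the test of Def. 6.4 for round `μ+1`, and of Def. 6.7) and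
the ℓ-test of Def. 6.8 — relations on NAMES, to be instantiated at scheme/chart level (rows 108/110; PARTITION-HU §6 (c):
this is where 𝔽 enters). The recorded output: `ρ_(kτ)` (finite — the packaging exists only «granting the finiteness»,
C45L143), `σ_(kτ)μ`, the listings `ϕ_(kτ)μh` as ordered pairs of names, and ONE pair of multiplicity tables on all names:
since proper transforms keep name AND multiplicities (Def. 6.6 first clause C45L54–L59, Def. 6.9 C46L90–L94), the
multiplicity of a divisor is a function of its name alone, fixed at its creation; the table «on the scheme
ℛ̃_{(℘_(kτ)𝔯_μ𝔰_h)}» is the restriction to `divsAt`. What the text requires of these data is `WpRun.IsAsPrinted`.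
[claim: Hu2025, status: under-review]
STATUS: candidate statement under adjudication (D-0012/D-0089); not asserted — OURS packaging. -/
structure WpRun (Bin : Type w) where
  /-- `ρ_(kτ)`, the number of rounds for `B_(kτ)` (Def. 6.7), assumed finite -/
  rho : W.IndexBgov → ℕ
  /-- `σ_(kτ)μ`, the number of ℘-sets of round `μ` (C44L32) -/
  sigma : W.IndexBgov → ℕ → ℕ
  /-- `ϕ_(kτ)μh = (Y⁺, Y⁻)`, `h ∈ [σ_(kτ)μ]` (C44L30), as an ordered pair of names (junk outside the range) -/
  phi : W.IndexBgov → ℕ → ℕ → W.Div × W.Div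
  /-- the multiplicities `m_{Y,T^i_B}` of every name -/
  tabB : W.AssocB Bin
  /-- the multiplicities `m_{Y,s}` of every name -/
  tabS : W.AssocS

namespace WpRun

variable {W}
variable {Bin : Type w}

/-- The `(kτ)`-column `Y ↦ m_{Y,T^i_(kτ)}` of the run's table (via the embedding `gov` of `Index_{𝓑^gov}` into `Bin`) — the
datum Def. 6.4/6.5 read. Plumbing.
[claim: Hu2025, status: under-review]
STATUS: candidate statement under adjudication (D-0012/D-0089); not asserted. -/
def col (R : W.WpRun Bin) (gov : W.IndexBgov → Bin) (kτ : W.IndexBgov) : W.Div → Fin 2 → ℕ :=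
  fun Y i => R.tabB Y (gov kτ) i

/-- **What §6.1–§6.2 require of a run (OURS packaging of the printed clauses; each conjunct cites its clause).**
(a) INITIAL: on the names of `ℛ̃_ϑ` the tables are the initial package (Def. 6.1/6.3, `IsInitialPackage`) — C43L1–L4 with
C43L57–L72.
(b) ROUNDS: for every `(kτ)` and `1 ≤ μ ≤ ρ_(kτ)`, the pairs `ϕ_(kτ)μ1, …, ϕ_(kτ)μσ_(kτ)μ` are pre-℘-sets over
`𝒟_{(℘_(kτ)𝔯_{μ−1})}` for the `(kτ)`-column and list EXACTLY the ℘-sets (test `meetsV kτ (μ−1)`) increasingly for Def. 6.5 —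
Def. 6.4, Def. 6.5, C44L28–L38.
(c) STEPS: the multiplicities of each new exceptional divisor `E_{·,(kτ)μh}`, `(kτ)μh ∈ Index_{Φ_k}`, are Def. 6.6's
(`Def6_6_exc`, `Def6_6_excS` from `ϕ_(kτ)μh`) — C45L61–L83; all other names keep theirs (C45L54–L59) — built into the
single-table packaging.
(d) TERMINATION OF ROUNDS: `ρ_(kτ)` is Def. 6.7's value (no pre-℘-set of round `ρ_(kτ)+1` passes the test, every earlier
round has a ℘-set) — C45L128–L137; finite by assumption of the packaging (C45L139).
(e) ℓ-STEP: the multiplicities of `E_{ℓ_k}` are those of `E_{℘_k,ϑ_k}` (Def. 6.9) — C46L96–L99 — for the columns Def. 6.9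
names («Fix any binomial B ∈ 𝓑^gov_G ⊔ B^𝔯𝔟 with G > F_k», C46L80–L81: the predicate `later k B`) and every `s`. (Whether the
ℓ_k-blow-up is performed is Def. 6.8's test `IsEllSet`; under the belief C46L50 it always is — not built in.) Instantiation
note: the rounds of a LATER block `k' > k` read the column of `B_(k'τ)` at `E_{ℓ_k}` (Def. 6.4 over `𝒟 ∋ E_{ℓ_k}`), which the
print covers since `G = F_{k'} > F_k`; accordingly `later k (gov ⟨k', τ⟩)` should hold whenever `k < k'` — with that and an
asymmetric `ltP` the data `ρ`, `σ`, `ϕ` of a run satisfying this predicate are uniquely determined by the tests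
(«canonical», C43L131–L133; kernel certificate `Proofs/S06WpEllBlowups/R107Canonical.lean`).
Stated with the order `ltP` on the Plücker variables (Def. 3.14 / 3.15, row 102), the embedding `gov` and the scope predicate
`later`. The test family is read with the printed identifications of stages (C43L12–L18 «(℘_(kτ)𝔯_0) := (℘_(k(τ−1))𝔯_{ρ_(k(τ−1))})
…, (℘_(k1)𝔯_0) := (℘_((k−1)𝔱_{F_{k−1}})𝔯_ρ)», C43L1–L4, C46L123–L126): `meetsV kτ 0` tests against the `Ṽ` of the stage
preceding round 1 of `B_(kτ)` (end of the previous binomial's rounds, `Ṽ_{ℓ_{k−1}}`, or `Ṽ` on `ℛ̃_ϑ`), and `meetsV kτ μ`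
for `μ > ρ_(kτ)` is never read by (b) and does not change the infimum in (d).
[claim: Hu2025, status: under-review]
STATUS: candidate statement under adjudication (D-0012/D-0089); not asserted — OURS packaging. -/
def IsAsPrinted (R : W.WpRun Bin) (ltP : P → P → Prop) (gov : W.IndexBgov → Bin)
    (later : Fin W.N → Bin → Prop) (meetsV : W.IndexBgov → ℕ → W.Div → W.Div → Prop) : Prop :=
  -- (a) initial package on 𝒟_ϑ
  (∀ Y ∈ W.divsTheta, (∀ kτ i, R.tabB Y (gov kτ) i = Def6_1 W Y kτ i) ∧ ∀ s, R.tabS Y s = Def6_3_ours W Y s) ∧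
  -- (b) rounds: the listed pairs are exactly the ℘-sets, in Def. 6.5's order
  (∀ (kτ : W.IndexBgov) (μ : ℕ), 1 ≤ μ → μ ≤ R.rho kτ →
    ∃ L : List (PreWpSet W (W.divsBefore R.rho R.sigma kτ μ) (R.col gov kτ)),
      W.IsPhiListing ltP kτ (meetsV kτ (μ - 1)) L ∧ L.length = R.sigma kτ μ ∧
      ∀ (h : ℕ) (hh : h < L.length), R.phi kτ μ (h + 1) = ((L.get ⟨h, hh⟩).plus, (L.get ⟨h, hh⟩).minus)) ∧
  -- (c) Def. 6.6 at each new ℘-exceptional divisor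
  (∀ (kτ : W.IndexBgov) (μ h : ℕ), W.IsIndexPhi R.rho R.sigma kτ.1 (kτ.2.val + 1) μ h →
    (∀ B i, R.tabB (Div.excWpOf kτ μ h) B i = W.Def6_6_exc R.tabB (R.phi kτ μ h).1 (R.phi kτ μ h).2 B i) ∧
    (∀ s, R.tabS (Div.excWpOf kτ μ h) s = W.Def6_6_excS R.tabS (R.phi kτ μ h).1 (R.phi kτ μ h).2 s)) ∧
  -- (d) ρ_(kτ) is Def. 6.7's least round with no ℘-set in the next one
  (∀ kτ : W.IndexBgov,
    (R.rho kτ : ℕ∞) =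
      Def6_7 W (fun μ => W.divsBefore R.rho R.sigma kτ (μ + 1)) (fun _ => R.col gov kτ) (fun μ => meetsV kτ μ)) ∧
  -- (e) Def. 6.9 at E_{ℓ_k}, for the columns the text names: B ∈ 𝓑^gov_G ⊔ 𝓑^𝔯𝔟 with G > F_k (`later k B`), and every s
  (∀ k : Fin W.N, (∀ B, later k B → ∀ i, R.tabB (Div.excEll k) B i = R.tabB (Div.excTheta k) B i) ∧
    ∀ s, R.tabS (Div.excEll k) s = R.tabS (Div.excTheta k) s)

end WpRun

end WpFrame

end Literature.AlgebraicGeometry.Hu2025.Statements.S06WpEllBlowups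

end
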